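import Literature.NumberTheory.LFunctions.KloostermanFractionsOffDiagCS
import HarnessLib

/-!
# Trilinear forms with Kloosterman fractions: eliminating `m` in an off-diagonal tuple (Bettin–Chandee §4.1.1, general `A`)

Topic `NumberTheory/LFunctions`.  S. Bettin, V. Chandee, *Trilinear forms with Kloosterman
fractions*, Adv. Math. 328 (2018), §4.1.1 "Introducing the complementary divisor": for the
off-diagonal terms one writes `md₀ = ℓ₁𝔭₁𝔭₂n₁' − ℓ₂𝔮₁𝔮₂n₂'`, divides `m` into the classes
`m ≡ c (mod b𝔮₁𝔭₂)`, and finds that the argument of the exponential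
"`ϑ(a₁m̄/(bn₁) − a₂m̄/(bn₂))` … is congruent modulo 1 to
`ϑ(−da₁(bℓ̃₂𝔮₂n₂')‾/(𝔭₁n₁') − da₂(ℓ̃₁𝔭₁n₁'b𝔮₁)‾/(𝔮₂n₂') + a₁(c𝔭₁n₁')‾/(b𝔭₂) − a₂(c𝔮₂n₂')‾/(b𝔮₁))`"
((vae)) — with the TWO numerators `ϑa₁`, `ϑa₂` of the trilinear form.  The tree's
`kfs_msum_tuple_eq` (`KloostermanFractionsOffDiagCS.lean`) is the case `a₁ = a₂` (`A = 1`),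
`𝔭ᵢ = 𝔮ᵢ = 1`.  This file PROVES the two-numerator version, carrying moreover an arbitrary extra
factor `t(m)` (for the twist `e(ηa₁/(m bn₁)) conj e(ηa₂/(m bn₂))` of Remark 2, which becomes a
function of `d` after the switch `m = w/d`):

* **`BC_off_msum_tuple_eq`** — for `ℓ₁ ≠ ℓ₂` primes, `(n₁,n₂) = 1`, `(n₁n₂, ℓ₁ℓ₂) = 1`,
  `(n₁,b) = (n₂,b) = 1`, `w = ℓ₁n₁ − ℓ₂n₂`, `|w| ≤ D(M₁+1)`:
  `∑_{M₁<m≤M₂,(m,b)=1} [(ℓ₂n₂,m)=1, ℓ₁n₁≡ℓ₂n₂ (m)] t(m) e(k₁m̄/(bn₁)) conj e(k₂m̄/(bn₂))`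
  `= ∑_{c∈(ℤ/b)^*} Ψ_c ∑_{0<|d|≤D : d∣w, M₁<w/d≤M₂, w/d≡c (b)} t(w/d) e(−k₁d(bℓ₂n₂)‾/n₁) conj e(−k₂d(−bℓ₁n₁)‾/n₂)`,
  `Ψ_c = e(k₁(cn₁)‾^{(b)}/b) conj e(k₂(cn₂)‾^{(b)}/b)`.

No new named facts (D-0026).

## References

* S. Bettin, V. Chandee, Adv. Math. 328 (2018) 1234–1262 (arXiv:1502.00769), §4.1.1 (vae).
  [BettinChandee2018]
* W. Duke, J. Friedlander, H. Iwaniec, Invent. Math. 128 (1997) 23–43. [DukeFriedlanderIwaniec1997]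
-/

noncomputable section

open Finset

namespace Literature.NumberTheory.LFunctions

/-- **Eliminating `m` for one nondegenerate coprime tuple, two numerators and a twist factor**
(Bettin–Chandee §4.1.1 (vae), `𝔭ᵢ = 𝔮ᵢ = 1`): see the module docstring.
[cite: BettinChandee2018, §4.1.1] -/
theorem BC_off_msum_tuple_eq (k₁ k₂ : ℤ) (t : ℕ → ℂ) {b : ℕ} (hb : 0 < b) (M₁ M₂ D : ℕ)
    {ℓ₁ ℓ₂ n₁ n₂ : ℕ} (hp₁ : ℓ₁.Prime) (hp₂ : ℓ₂.Prime) (hne : ℓ₁ ≠ ℓ₂) (hn : n₁.Coprime n₂)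
    (hnl : (n₁ * n₂).Coprime (ℓ₁ * ℓ₂)) (hn₁ : 0 < n₁) (hn₂ : 0 < n₂) (hb₁ : n₁.Coprime b)
    (hb₂ : n₂.Coprime b) (hD : ((ℓ₁ * n₁ : ℤ) - ℓ₂ * n₂).natAbs ≤ D * (M₁ + 1)) :
    ∑ m ∈ (Ioc M₁ M₂).filter (fun m => m.Coprime b),
        (if (ℓ₂ * n₂).Coprime m ∧ ((ℓ₁ * n₁ : ℕ) : ZMod m) = ((ℓ₂ * n₂ : ℕ) : ZMod m) then
          t m * (Complex.exp (2 * Real.pi * Complex.I *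
              ((k₁ : ℂ) * ((((m : ZMod (b * n₁))⁻¹).val : ℕ) : ℂ) / ((b * n₁ : ℕ) : ℂ))) *
            (starRingEnd ℂ) (Complex.exp (2 * Real.pi * Complex.I *
              ((k₂ : ℂ) * ((((m : ZMod (b * n₂))⁻¹).val : ℕ) : ℂ) / ((b * n₂ : ℕ) : ℂ)))))
        else 0) =
      ∑ c ∈ (Finset.range b).filter (fun c => c.Coprime b),
        (Complex.exp (2 * Real.pi * Complex.I *
            ((k₁ : ℂ) * ((((((c : ℤ) * n₁ : ℤ) : ZMod b)⁻¹).val : ℕ) : ℂ) / (b : ℂ))) *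
          (starRingEnd ℂ) (Complex.exp (2 * Real.pi * Complex.I *
            ((k₂ : ℂ) * ((((((c : ℤ) * n₂ : ℤ) : ZMod b)⁻¹).val : ℕ) : ℂ) / (b : ℂ))))) *
        ∑ d ∈ (Icc (-(D : ℤ)) D).erase 0,
          (if d ∣ ((ℓ₁ * n₁ : ℤ) - ℓ₂ * n₂) ∧ (M₁ : ℤ) < ((ℓ₁ * n₁ : ℤ) - ℓ₂ * n₂) / d ∧
              ((ℓ₁ * n₁ : ℤ) - ℓ₂ * n₂) / d ≤ M₂ ∧
              ((ℓ₁ * n₁ : ℤ) - ℓ₂ * n₂) / d ≡ (c : ℤ) [ZMOD b] then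
            t ((((ℓ₁ * n₁ : ℤ) - ℓ₂ * n₂) / d).toNat) *
              (Complex.exp (2 * Real.pi * Complex.I *
                  (((-(k₁ * d) : ℤ) : ℂ) * (((((b * (ℓ₂ * n₂ : ℤ) : ℤ) : ZMod n₁)⁻¹).val : ℕ) : ℂ) /
                    (n₁ : ℂ))) *
                (starRingEnd ℂ) (Complex.exp (2 * Real.pi * Complex.I *
                  (((-(k₂ * d) : ℤ) : ℂ) *
                    (((((b * (-(ℓ₁ * n₁ : ℤ)) : ℤ) : ZMod n₂)⁻¹).val : ℕ) : ℂ) / (n₂ : ℂ)))))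
            else 0) := by
  classical
  set w : ℤ := (ℓ₁ * n₁ : ℤ) - ℓ₂ * n₂ with hw
  have hw0 : w ≠ 0 := kfs_ne_of_coprime hp₁ hp₂ hne hn hnl hn₂
  have hcopp := kfs_coprime_prods hp₁ hp₂ hne hn hnl
  -- notation for the phases
  set e : ℤ → ℕ → ℕ → ℂ := fun k q m => Complex.exp (2 * Real.pi * Complex.I *
    ((k : ℂ) * ((((m : ZMod q)⁻¹).val : ℕ) : ℂ) / (q : ℂ))) with he
  set P₁ : ℤ → ℂ := fun x => Complex.exp (2 * Real.pi * Complex.I *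
    ((k₁ : ℂ) * ((((x : ZMod b)⁻¹).val : ℕ) : ℂ) / (b : ℂ))) with hP₁
  set P₂ : ℤ → ℂ := fun x => Complex.exp (2 * Real.pi * Complex.I *
    ((k₂ : ℂ) * ((((x : ZMod b)⁻¹).val : ℕ) : ℂ) / (b : ℂ))) with hP₂
  set Q₁ : ℤ → ℂ := fun d => Complex.exp (2 * Real.pi * Complex.I *
    (((-(k₁ * d) : ℤ) : ℂ) * (((((b * (ℓ₂ * n₂ : ℤ) : ℤ) : ZMod n₁)⁻¹).val : ℕ) : ℂ) /
      (n₁ : ℂ))) with hQ₁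
  set Q₂ : ℤ → ℂ := fun d => Complex.exp (2 * Real.pi * Complex.I *
    (((-(k₂ * d) : ℤ) : ℂ) * (((((b * (-(ℓ₁ * n₁ : ℤ)) : ℤ) : ZMod n₂)⁻¹).val : ℕ) : ℂ) /
      (n₂ : ℂ))) with hQ₂
  set F : ℕ → ℂ := fun m => t m * (e k₁ (b * n₁) m * (starRingEnd ℂ) (e k₂ (b * n₂) m)) with hF
  -- the left-hand summand in terms of `e`
  have hsummand : ∀ m : ℕ,
      t m * (Complex.exp (2 * Real.pi * Complex.I *
          ((k₁ : ℂ) * ((((m : ZMod (b * n₁))⁻¹).val : ℕ) : ℂ) / ((b * n₁ : ℕ) : ℂ))) *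
        (starRingEnd ℂ) (Complex.exp (2 * Real.pi * Complex.I *
          ((k₂ : ℂ) * ((((m : ZMod (b * n₂))⁻¹).val : ℕ) : ℂ) / ((b * n₂ : ℕ) : ℂ))))) = F m := by
    intro m; simp only [hF, he]
  simp_rw [hsummand]
  -- Step 1: the condition is `m ∣ w`
  have h1 : ∀ m, (if (ℓ₂ * n₂).Coprime m ∧ ((ℓ₁ * n₁ : ℕ) : ZMod m) = ((ℓ₂ * n₂ : ℕ) : ZMod m)
      then F m else 0) = (if (m : ℤ) ∣ w then F m else 0) := by
    intro m
    by_cases h : (m : ℤ) ∣ w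
    · rw [if_pos h, if_pos ((kfs_cond_iff_dvd hcopp m).mpr h)]
    · rw [if_neg h, if_neg (fun h' => h ((kfs_cond_iff_dvd hcopp m).mp h'))]
  rw [Finset.sum_congr rfl (fun m _ => h1 m), kfs_msum_eq_dsum hw0 b M₁ M₂ D hD F]
  -- Step 2: expand the right-hand side and compare termwise in `d`
  simp_rw [Finset.mul_sum]
  rw [Finset.sum_comm]
  refine Finset.sum_congr rfl fun d hd => ?_
  by_cases hA : d ∣ w ∧ (M₁ : ℤ) < w / d ∧ w / d ≤ M₂
  · obtain ⟨hdw, hM1, hM2⟩ := hA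
    set q₀ : ℤ := w / d with hq₀
    have hq₀d : q₀ * d = w := Int.ediv_mul_cancel hdw
    have hq₀0 : 0 ≤ q₀ := le_trans (by positivity) hM1.le
    have hm' : ((q₀.toNat : ℕ) : ℤ) = q₀ := Int.toNat_of_nonneg hq₀0
    -- the class sum collapses
    have hclass : ∑ c ∈ (Finset.range b).filter (fun c => c.Coprime b),
        (if q₀ ≡ (c : ℤ) [ZMOD b] then P₁ ((c : ℤ) * n₁) * (starRingEnd ℂ) (P₂ ((c : ℤ) * n₂))
          else 0) =
        if Int.gcd q₀ b = 1 then P₁ (q₀ * n₁) * (starRingEnd ℂ) (P₂ (q₀ * n₂)) else 0 := by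
      have hsc := kfs_split_classes hb q₀
        (fun c => P₁ ((c : ℤ) * n₁) * (starRingEnd ℂ) (P₂ ((c : ℤ) * n₂)))
      beta_reduce at hsc
      rw [← hsc]
      by_cases hg : Int.gcd q₀ b = 1
      · rw [if_pos hg, if_pos hg]
        have hmod : q₀ ≡ ((q₀ % b).toNat : ℤ) [ZMOD b] := by
          rw [Int.toNat_of_nonneg (Int.emod_nonneg _ (by exact_mod_cast hb.ne'))]
          exact (Int.emod_emod_of_dvd _ (dvd_refl _)).symm
        simp only [hP₁, hP₂]
        rw [kfs_phase_mod_b k₁ b n₁ hmod, kfs_phase_mod_b k₂ b n₂ hmod]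
      · rw [if_neg hg, if_neg hg]
    -- the left-hand side in factored form
    have hLHS : (if d ∣ w ∧ (M₁ : ℤ) < w / d ∧ w / d ≤ M₂ ∧ Int.gcd (w / d) b = 1 then
        F (w / d).toNat else 0) =
        t q₀.toNat * ((if Int.gcd q₀ b = 1 then
          P₁ (q₀ * n₁) * (starRingEnd ℂ) (P₂ (q₀ * n₂)) else 0) *
            (Q₁ d * (starRingEnd ℂ) (Q₂ d))) := by
      by_cases hg : Int.gcd q₀ b = 1
      · rw [if_pos ⟨hdw, hM1, hM2, hg⟩, if_pos hg]
        -- coprimality of `m' = q₀` with `b n₁` and `b n₂`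
        have hc1 : (q₀.toNat).Coprime (b * n₁) := by
          refine Nat.Coprime.mul_right ?_ ?_
          · rw [Nat.coprime_iff_gcd_eq_one, ← Int.gcd_natCast_natCast, hm']; exact hg
          · rw [Nat.coprime_iff_gcd_eq_one, ← Int.gcd_natCast_natCast, hm']
            exact kfs_gcd_quot_left (Nat.Coprime.coprime_mul_left_right hcopp.symm) hq₀d
        have hc2 : (q₀.toNat).Coprime (b * n₂) := by
          refine Nat.Coprime.mul_right ?_ ?_
          · rw [Nat.coprime_iff_gcd_eq_one, ← Int.gcd_natCast_natCast, hm']; exact hg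
          · rw [Nat.coprime_iff_gcd_eq_one, ← Int.gcd_natCast_natCast, hm']
            exact kfs_gcd_quot_right (Nat.Coprime.coprime_mul_left_right hcopp) hq₀d
        -- units for the substitution
        have hu1 : IsUnit ((b * (ℓ₂ * n₂ : ℤ) : ℤ) : ZMod n₁) := by
          have : ((b * (ℓ₂ * n₂ : ℤ) : ℤ) : ZMod n₁) = ((b * (ℓ₂ * n₂) : ℕ) : ZMod n₁) := by
            push_cast; ring
          rw [this, ZMod.isUnit_iff_coprime]
          exact Nat.Coprime.mul_left hb₁.symm (Nat.Coprime.coprime_mul_left_right hcopp.symm)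
        have hu2 : IsUnit ((b * (-(ℓ₁ * n₁ : ℤ)) : ℤ) : ZMod n₂) := by
          have : ((b * (-(ℓ₁ * n₁ : ℤ)) : ℤ) : ZMod n₂) = -((b * (ℓ₁ * n₁) : ℕ) : ZMod n₂) := by
            push_cast; ring
          rw [this, IsUnit.neg_iff, ZMod.isUnit_iff_coprime]
          exact Nat.Coprime.mul_left hb₂.symm (Nat.Coprime.coprime_mul_left_right hcopp)
        have hdvd1 : (n₁ : ℤ) ∣ w + (ℓ₂ * n₂ : ℤ) := ⟨ℓ₁, by rw [hw]; ring⟩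
        have hdvd2 : (n₂ : ℤ) ∣ w + (-(ℓ₁ * n₁ : ℤ)) := ⟨-ℓ₂, by rw [hw]; ring⟩
        -- the two phases
        have he1 : e k₁ (b * n₁) q₀.toNat = P₁ (q₀ * n₁) * Q₁ d := by
          simp only [he, hP₁, hQ₁]
          rw [kfs_phase_factor k₁ hb hn₁ hb₁.symm hc1, hm',
            kfs_phase_subst k₁ hn₁ (b := b) hq₀d hdvd1 hu1]
        have he2 : e k₂ (b * n₂) q₀.toNat = P₂ (q₀ * n₂) * Q₂ d := by
          simp only [he, hP₂, hQ₂]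
          rw [kfs_phase_factor k₂ hb hn₂ hb₂.symm hc2, hm',
            kfs_phase_subst k₂ hn₂ (b := b) hq₀d hdvd2 hu2]
        simp only [hF, ← hq₀]
        rw [he1, he2]
        simp only [map_mul]
        ring
      · have : ¬ (d ∣ w ∧ (M₁ : ℤ) < w / d ∧ w / d ≤ M₂ ∧ Int.gcd (w / d) b = 1) :=
          fun h => hg h.2.2.2
        rw [if_neg this, if_neg hg]
        ring
    rw [hLHS, ← hclass, Finset.sum_mul, Finset.mul_sum]
    refine Finset.sum_congr rfl fun c _ => ?_
    by_cases hc : q₀ ≡ (c : ℤ) [ZMOD b]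
    · rw [if_pos hc, if_pos ⟨hdw, hM1, hM2, hc⟩]
      simp only [hP₁, hP₂, hQ₁, hQ₂]
      ring
    · have : ¬ (d ∣ w ∧ (M₁ : ℤ) < w / d ∧ w / d ≤ M₂ ∧ w / d ≡ (c : ℤ) [ZMOD b]) :=
        fun h => hc h.2.2.2
      rw [if_neg hc, if_neg this]
      ring
  · -- `d` does not contribute on either side
    have hL : ¬ (d ∣ w ∧ (M₁ : ℤ) < w / d ∧ w / d ≤ M₂ ∧ Int.gcd (w / d) b = 1) :=
      fun h => hA ⟨h.1, h.2.1, h.2.2.1⟩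
    rw [if_neg hL]
    symm
    refine Finset.sum_eq_zero fun c _ => ?_
    have : ¬ (d ∣ w ∧ (M₁ : ℤ) < w / d ∧ w / d ≤ M₂ ∧ w / d ≡ (c : ℤ) [ZMOD b]) :=
      fun h => hA ⟨h.1, h.2.1, h.2.2.1⟩
    rw [if_neg this]
    ring

end Literature.NumberTheory.LFunctions

end
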